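import Summits.ResolutionOfSingularities.ResolutionOfSingularities.Theorems.StrictDrop.Negative.StrictDropFalseOfSelfSimilarSeed
import HarnessLib

/-!
# Crux `NoZenoR` (stmt-ResolutionOfSingularities-19943): THE TOWER IS EQUIVARIANT — TORIC DATA STAY TORIC

OURS (cell res-hironaka, crux chain W4.4; lead res-L0-w44-lead-1 g10, DESK WORD 43 (c) OBJECT 2-Y).  AI-written, weaker than expert review;
nothing here is a statement of the manuscript under review (Hironaka 2017).  SUPPORT-level, counted 0.  Def-free, fact-free.

The `σ`-equivariance of the canonical operator `T ↦ loc O (nrm (chart O T))` under a `k`-automorphism `σ` of `K` preserving the valuation ring `O`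
is PROVED in the tree (`StrictDrop.Negative.SelfSimilar.step_map`, `loc_map_le`, `ca_map`; negative lemma `StrictDrop_false_of_SelfSimilarSeed`).
Here the two POSITIVE consequences the E-ZENO-toric model needs:

* `loc_map` — `σ(loc O T) = loc O (σ T)`;  `tower_map` — `σ(T_m(A)) = T_m(σ A)` for every stage: the whole tower is `σ`-equivariant;
* `tower_stable` — if `σ A = A` then `σ T_m = T_m` for all `m`, and `ca_tower_stable` — `σ(ca T_m) = ca T_m`: every TORUS-STABLE datum
  (`A` monomial, `O` a monomial/weight valuation, `σ` ranging over the torus automorphisms preserving `O`) has torus-stable stages and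
  torus-stable cohomology annihilators, so a toric model computes THE tower (the typed form of a toric Zeno loop being
  `SelfSimilarSeed → ¬ StrictDrop`).

References: Castillo, Duarte, Leyton-Álvarez, Liendo, Ann. Math. 203 (2026) [`CastilloEtAl2024`] (the loop shape); Iyengar–Takahashi 2016
Def. 2.1 [`IyengarTakahashi2014`] (intrinsic `ca`, tree `SelfSimilar.ca_map`).
-/

noncomputable section

-- single-problem summit: the doubled namespace component `ResolutionOfSingularities` is forced
set_option linter.dupNamespace false

namespace Summit.ResolutionOfSingularities.ResolutionOfSingularities.Theorems.NoZeno.Equivariance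

open Summit.ResolutionOfSingularities.ResolutionOfSingularities.Theorems.NoZeno.Birth
open Summit.ResolutionOfSingularities.ResolutionOfSingularities.Theorems.StrictDrop.Negative.SelfSimilar

variable {k K : Type} [Field k] [Field K] [Algebra k K] (O : ValuationSubring K)

/-- **`σ(loc O T) = loc O (σ T)`** for `σ` preserving `O` (tree `loc_map_le` both ways). [folklore] -/
theorem loc_map {σ : K ≃ₐ[k] K} (hσ : ∀ z : K, σ z ∈ O ↔ z ∈ O) (T : Subalgebra k K) :
    (loc O T).map (σ : K →ₐ[k] K) = loc O (T.map (σ : K →ₐ[k] K)) := by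
  refine le_antisymm (loc_map_le O hσ T) ?_
  have h := loc_map_le O (symm_mem_iff O hσ) (T.map (σ : K →ₐ[k] K))
  rw [map_map_symm] at h
  have h' := Subalgebra.map_mono (f := (σ : K →ₐ[k] K)) h
  rwa [map_symm_map] at h'

/-- **THE TOWER IS `σ`-EQUIVARIANT**: `σ(T_m(A)) = T_m(σ A)` for every stage, `σ` a `k`-automorphism of `K` preserving `O` (induction on
`m`: `tower_zero`/`loc_map`, `tower_succ`/`step_map`). [this work] -/
theorem tower_map {σ : K ≃ₐ[k] K} (hσ : ∀ z : K, σ z ∈ O ↔ z ∈ O) (A : Subalgebra k K) (m : ℕ) :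
    (tower O A m).map (σ : K →ₐ[k] K) = tower O (A.map (σ : K →ₐ[k] K)) m := by
  induction m with
  | zero => rw [tower_zero, tower_zero, loc_map O hσ]
  | succ m ih => rw [tower_succ, tower_succ, step_map O hσ, ih]

/-- **TORIC DATA STAY TORIC**: if `σ` preserves `O` and `σ A = A`, then `σ T_m = T_m` for every stage. [this work] -/
theorem tower_stable {σ : K ≃ₐ[k] K} (hσ : ∀ z : K, σ z ∈ O ↔ z ∈ O) {A : Subalgebra k K}
    (hσA : A.map (σ : K →ₐ[k] K) = A) (m : ℕ) : (tower O A m).map (σ : K →ₐ[k] K) = tower O A m := by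
  rw [tower_map O hσ, hσA]

/-- Membership form: under stability, `σ z ∈ T_m ↔ z ∈ T_m`. [this work] -/
theorem mem_tower_iff_of_stable {σ : K ≃ₐ[k] K} (hσ : ∀ z : K, σ z ∈ O ↔ z ∈ O) {A : Subalgebra k K}
    (hσA : A.map (σ : K →ₐ[k] K) = A) (m : ℕ) (z : K) : σ z ∈ tower O A m ↔ z ∈ tower O A m := by
  constructor
  · intro hz
    have h : σ z ∈ (tower O A m).map (σ : K →ₐ[k] K) := by rw [tower_stable O hσ hσA]; exact hz
    obtain ⟨y, hy, hyz⟩ := Subalgebra.mem_map.mp h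
    rwa [← σ.injective hyz]
  · intro hz
    rw [← tower_stable O hσ hσA m]
    exact Subalgebra.mem_map.mpr ⟨z, hz, rfl⟩

/-- **The cohomology annihilators of a stable tower are stable**: `σ(ca T_m) = ca T_m` (tree `ca_map`). [this work] -/
theorem ca_tower_stable {σ : K ≃ₐ[k] K} (hσ : ∀ z : K, σ z ∈ O ↔ z ∈ O) {A : Subalgebra k K}
    (hσA : A.map (σ : K →ₐ[k] K) = A) (m : ℕ) : σ '' ca (tower O A m) = ca (tower O A m) := by
  rw [← ca_map, tower_stable O hσ hσA]

/-- If `σ` preserves `O` and maps a generating set of `A` into `A` bijectively-enough (`σ '' S = S` for `A = k[S]`), then `σ A = A`.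
[bookkeeping] -/
theorem map_adjoin_eq_of_image_eq (σ : K ≃ₐ[k] K) {S : Set K} (hS : σ '' S = S) :
    (Algebra.adjoin k S).map (σ : K →ₐ[k] K) = Algebra.adjoin k S := by
  rw [AlgHom.map_adjoin]
  change Algebra.adjoin k (σ '' S) = _
  rw [hS]

end Summit.ResolutionOfSingularities.ResolutionOfSingularities.Theorems.NoZeno.Equivariance

end
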